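import Summits.MatrixMultiplication.MatrixMultiplication.Theorems.ObstructionDescentUniversalOccurrenceTwoRectangleFloor

set_option linter.dupNamespace false
set_option autoImplicit false

/-!
# Universal occurrence — two rectangles, part X: the STOREY LAW (lifted slices of `⟨R⟩`) (decomp-mm · lens 3 · gen 44)

Route `route-MatrixMultiplication-ObstructionDescent` (sub-problem `MatrixMultiplication`, `ω(ℂ) = 2`); SUPPORT for the crux
`NoOccurrenceObstruction` (`P_O`, item `stmt-MatrixMultiplication-29040`) through the universal-occurrence programme (NODE-g29…g44
of the decomp-mm cell, lens 3).  Nothing here proves `ω = 2` or closes an item; no `def`, no `sorry`, standard axioms.  Closure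
currency as in parts I–IX and A–E: "`(λ⁰,λ¹,λ²)` occurs for `s`" is `isotypicSum₁ λ⁰ (isotypicSum₂ λ¹ (isotypicSum₃ λ² (s^{⊗d}))) ≠ 0`.

**Why (census v54, rows I238/I-g54d: "the four-odd class is the ENTIRE untouched remainder of the two-rectangular sector").**
Part IX (the floor law, `occurs_unitTensor_twoRectangle_of_pairing_ne_zero`) certifies `((δ^N),(δ^N),ν) ∈ S(⟨m⟩)`, `m ≥ N`, from
the diagonal slices `t₀(c) = ∑ᵢ eᵢ ⊗ eᵢ ⊗ cᵢ` of `⟨N⟩` (border rank `≤ N`).  For `δ = 2` every word `g ∘ w_σ` fed to the third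
leg has EVEN content, so the floor law reaches only third legs `ν ⊢ 2N` with all parts even (parts A–E, K27: all such `ν` with
`≤ 4` rows and `ν₃ ≤ 2`).  The types with four ODD parts — Bürgisser–Ikenmeyer's `((2^4),(2^4),(5,1,1,1)) ∉ S°(⟨5⟩)` (2011,
Lemma 6.1) is the first — do not even lie in the orbit closure `S°(⟨N+1⟩)`: they need witnesses of border rank `≥ N + 2`, i.e.
slices of `⟨R⟩` with `R > N` ("one storey up").  This file is the general tool for that: the evaluation law and the occurrence
law for the LIFTED SLICES `t_{φ,ψ}(c) := ∑_{r<R} e_{φ r} ⊗ e_{ψ r} ⊗ c_r ∈ (ℂ^N)^{⊗3}` (`φ, ψ : [R] → [N]` arbitrary collision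
maps; `t₀(c)` is `R = N`, `φ = ψ = id`).  Part XI uses it with `R = N + 2` and two CROSSED lifts (`φ(N) = ψ(N+1) = 0`,
`φ(N+1) = ψ(N) = 1`) to certify the first uniform four-odd family `((2^N),(2^N),(2N-3,1,1,1)) ∈ S(⟨m⟩)`, `m ≥ N + 2`.

**Contents.**  §1: `t_{φ,ψ}(c) = ∑_r δ_{φ r} ⊗ δ_{ψ r} ⊗ c_r` has rank, hence border rank, `≤ R` (`algBorderRank_liftSlice_le`).
§2: its tensor powers on words, `t_{φ,ψ}(c)^{⊗D}(u,v,w) = ∑_{ι : [D] → [R], φ∘ι = u, ψ∘ι = v} ∏_q c_{ι q, w q}`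
(`kroneckerPow_liftSlice`), and two block-sign facts (`bijective_of_wordBlockSign_ne_zero`, `wordBlockSign_mul_self_of_ne_zero`).
§3 (evaluation law): `⟪ζ_e ⊗ ζ_{e'} ⊗ M, t_{φ,ψ}(c)^{⊗D}⟫ = ∑_ι ζ_e(φ∘ι) ζ_{e'}(ψ∘ι) ∑_w M(w) ∏_q c_{ι q, w q}`
(`pairing_liftSlice_blockSign_blockSign`; general trilinear form `pairing_liftSlice`), the collapse of the `ι`-sum against a block
sign (`sum_wordBlockSign_comp_mul`) and of the inner sum at an indicator colouring `c_r = δ_{γ r}` (`sum_mul_prod_indicator_word_eq`).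
§4 (THE STOREY LAW, `occurs_unitTensor_twoRectangle_of_liftPairing_ne_zero`, design form `…_of_liftDesign_ne_zero`): if
`∑_ι ζ_e(φ∘ι) ζ_{e'}(ψ∘ι) M(γ∘ι) ≠ 0` for a highest-weight vector `M` of weight `λ²` and block structures `e, e'`, then
`((δ^N),(δ^N),λ²)` occurs for `⟨m⟩` for every `m ≥ max(N, R)`.

[cite: BurgisserIkenmeyer2011, §3.4 (Prop. 3.4), Thm. 4.4, Lemma 6.1] [cite: BurgisserIkenmeyer2017, §5, Thm. 5.9 (proof of (2)), eq. (3.4)]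
[cite: Landsberg2017, §9.1.1]
-/

noncomputable section

open scoped BigOperators

namespace Summit.MatrixMultiplication.MatrixMultiplication.Theorems.ObstructionCalculus

open Literature.Computability.AlgebraicComplexity
open Literature.NumberTheory.DiophantineGeometry (Word Word3 wordRep highestWeightSpace Weight tripleHw mem_tripleHw_iff)

/-! ### §1 The lifted slices `t_{φ,ψ}(c) = ∑_{r<R} e_{φ r} ⊗ e_{ψ r} ⊗ c_r` -/

/-- `t_{φ,ψ}(c)` is a sum of `R` triads. [folklore] -/
theorem liftSlice_eq_sum_triad {N R : ℕ} (φ ψ : Fin R → Fin N) (c : Fin R → Fin N → ℂ) :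
    (fun i j l : Fin N => ∑ r : Fin R, if φ r = i ∧ ψ r = j then c r l else 0) =
      ∑ r : Fin R, triad (Pi.single (φ r) (1 : ℂ)) (Pi.single (ψ r) (1 : ℂ)) (c r) := by
  classical
  funext i j l
  rw [Finset.sum_apply, Finset.sum_apply, Finset.sum_apply]
  refine Finset.sum_congr rfl fun r _ => ?_
  rw [triad_apply, Pi.single_apply, Pi.single_apply]
  by_cases h1 : φ r = i
  · by_cases h2 : ψ r = j
    · rw [if_pos ⟨h1, h2⟩, if_pos h1.symm, if_pos h2.symm, one_mul, one_mul]
    · rw [if_neg (fun h => h2 h.2), if_pos h1.symm, if_neg (fun h => h2 h.symm)]; ring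
  · rw [if_neg (fun h => h1 h.1), if_neg (fun h => h1 h.symm)]; ring

/-- **`R̲(t_{φ,ψ}(c)) ≤ R(t_{φ,ψ}(c)) ≤ R`**: a lifted slice is a restriction of `⟨R⟩`. [folklore] -/
theorem algBorderRank_liftSlice_le {N R : ℕ} (φ ψ : Fin R → Fin N) (c : Fin R → Fin N → ℂ) :
    algBorderRank (fun i j l : Fin N => ∑ r : Fin R, if φ r = i ∧ ψ r = j then c r l else 0) ≤ R :=
  (algBorderRank_le_tensorRank _).trans
    (tensorRank_le_of_eq_sum (fun r => Pi.single (φ r) (1 : ℂ)) (fun r => Pi.single (ψ r) (1 : ℂ)) c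
      (liftSlice_eq_sum_triad φ ψ c))

/-! ### §2 Tensor powers of a lifted slice on words; two block-sign facts -/

/-- `t_{φ,ψ}(c)^{⊗D}(u,v,w) = ∑_{ι : [D] → [R]} [φ ∘ ι = u] [ψ ∘ ι = v] ∏_q c_{ι q, w q}`. [folklore] -/
theorem kroneckerPow_liftSlice {N R D : ℕ} (φ ψ : Fin R → Fin N) (c : Fin R → Fin N → ℂ) (u v w : Word N D) :
    kroneckerPow (fun i j l : Fin N => ∑ r : Fin R, if φ r = i ∧ ψ r = j then c r l else 0) D u v w =
      ∑ ι : Fin D → Fin R, if φ ∘ ι = u ∧ ψ ∘ ι = v then ∏ q, c (ι q) (w q) else 0 := by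
  classical
  rw [kroneckerPow_apply]
  have hex := Finset.prod_univ_sum (fun _ : Fin D => (Finset.univ : Finset (Fin R)))
    fun q r => (if φ r = u q ∧ ψ r = v q then c r (w q) else 0)
  rw [Fintype.piFinset_univ] at hex
  rw [hex]
  refine Finset.sum_congr rfl fun ι _ => ?_
  by_cases h : φ ∘ ι = u ∧ ψ ∘ ι = v
  · rw [if_pos h]
    exact Finset.prod_congr rfl fun q _ => if_pos ⟨congrFun h.1 q, congrFun h.2 q⟩
  · rw [if_neg h]
    obtain ⟨q, hq⟩ : ∃ q, ¬ (φ (ι q) = u q ∧ ψ (ι q) = v q) := by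
      by_contra hc
      exact h ⟨funext fun q => (not_not.1 (not_exists.1 hc q)).1, funext fun q => (not_not.1 (not_exists.1 hc q)).2⟩
    exact Finset.prod_eq_zero (Finset.mem_univ q) (if_neg hq)

/-- A non-zero block sign means every block carries each letter exactly once. [cite: BurgisserIkenmeyer2017, Thm. 5.9 (proof of (2))] -/
theorem bijective_of_wordBlockSign_ne_zero {D δ N : ℕ} (e : Fin D ≃ Fin δ × Fin N) {u : Word N D}
    (h : wordBlockSign ℂ e u ≠ 0) (a : Fin δ) : Function.Bijective (fun j => u (e.symm (a, j))) := by
  unfold wordBlockSign at h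
  by_cases hb : ∀ a, Function.Bijective (fun j => u (e.symm (a, j)))
  · exact hb a
  · exact absurd (if_neg hb) h

/-- A non-zero block sign squares to `1`. [folklore] -/
theorem wordBlockSign_mul_self_of_ne_zero {D δ N : ℕ} (e : Fin D ≃ Fin δ × Fin N) {u : Word N D}
    (h : wordBlockSign ℂ e u ≠ 0) : wordBlockSign ℂ e u * wordBlockSign ℂ e u = 1 := by
  unfold wordBlockSign at h ⊢
  by_cases hb : ∀ a, Function.Bijective (fun j => u (e.symm (a, j)))
  · rw [if_pos hb, ← Finset.prod_mul_distrib]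
    exact Finset.prod_eq_one fun a _ => by
      rw [← Int.cast_mul, ← Units.val_mul, Int.units_mul_self, Units.val_one, Int.cast_one]
  · exact absurd (if_neg hb) h

/-! ### §3 The evaluation law for lifted slices -/

/-- **Trilinear evaluation of `t_{φ,ψ}(c)^{⊗D}`**: `∑_{u,v,w} t^{⊗D}(u,v,w) F(u,v,w) = ∑_ι ∑_w (∏_q c_{ι q,w q}) F(φ∘ι, ψ∘ι, w)`.
[this node] -/
theorem pairing_liftSlice {N R D : ℕ} (φ ψ : Fin R → Fin N) (c : Fin R → Fin N → ℂ)
    (F : Word N D → Word N D → Word N D → ℂ) :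
    ∑ u, ∑ v, ∑ w, kroneckerPow (fun i j l : Fin N => ∑ r : Fin R, if φ r = i ∧ ψ r = j then c r l else 0) D u v w *
        F u v w =
      ∑ ι : Fin D → Fin R, ∑ w, (∏ q, c (ι q) (w q)) * F (φ ∘ ι) (ψ ∘ ι) w := by
  classical
  have key : ∀ u v w : Word N D,
      kroneckerPow (fun i j l : Fin N => ∑ r : Fin R, if φ r = i ∧ ψ r = j then c r l else 0) D u v w * F u v w =
        ∑ ι : Fin D → Fin R, if φ ∘ ι = u ∧ ψ ∘ ι = v then (∏ q, c (ι q) (w q)) * F u v w else 0 := by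
    intro u v w
    rw [kroneckerPow_liftSlice, Finset.sum_mul]
    refine Finset.sum_congr rfl fun ι _ => ?_
    split_ifs <;> simp
  simp_rw [key]
  -- bring `∑ ι` to the front
  rw [Finset.sum_congr rfl fun u _ => Finset.sum_congr rfl fun v _ => Finset.sum_comm]
  rw [Finset.sum_congr rfl fun u _ => Finset.sum_comm, Finset.sum_comm]
  refine Finset.sum_congr rfl fun ι _ => ?_
  rw [Finset.sum_eq_single (φ ∘ ι)]
  · rw [Finset.sum_eq_single (ψ ∘ ι)]
    · exact Finset.sum_congr rfl fun w _ => if_pos ⟨rfl, rfl⟩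
    · intro v _ hv
      exact Finset.sum_eq_zero fun w _ => if_neg fun h => hv h.2.symm
    · intro h; exact absurd (Finset.mem_univ _) h
  · intro u _ hu
    exact Finset.sum_eq_zero fun v _ => Finset.sum_eq_zero fun w _ => if_neg fun h => hu h.1.symm
  · intro h; exact absurd (Finset.mem_univ _) h

/-- **Evaluation law (lifted slice, two block structures).**
`⟪ζ_e ⊗ ζ_{e'} ⊗ M, t_{φ,ψ}(c)^{⊗D}⟫ = ∑_{ι : [D] → [R]} ζ_e(φ ∘ ι) · ζ_{e'}(ψ ∘ ι) · ∑_w M(w) ∏_q c_{ι q, w q}`. [this node] -/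
theorem pairing_liftSlice_blockSign_blockSign {N R D δ δ' : ℕ} (φ ψ : Fin R → Fin N) (c : Fin R → Fin N → ℂ)
    (e : Fin D ≃ Fin δ × Fin N) (e' : Fin D ≃ Fin δ' × Fin N) (M : Word N D → ℂ) :
    ∑ u, ∑ v, ∑ w, kroneckerPow (fun i j l : Fin N => ∑ r : Fin R, if φ r = i ∧ ψ r = j then c r l else 0) D u v w *
        (wordBlockSign ℂ e u * wordBlockSign ℂ e' v * M w) =
      ∑ ι : Fin D → Fin R, wordBlockSign ℂ e (φ ∘ ι) *
        (wordBlockSign ℂ e' (ψ ∘ ι) * ∑ w, M w * ∏ q, c (ι q) (w q)) := by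
  rw [pairing_liftSlice]
  refine Finset.sum_congr rfl fun ι _ => ?_
  rw [Finset.mul_sum, Finset.mul_sum]
  refine Finset.sum_congr rfl fun w _ => ?_
  ring

/-- **Collapsing the `ι`-sum against a block sign**: `∑_ι ζ_e(φ∘ι) G(ι) = ∑_{σ ∈ S_N^δ} sgn(σ) ∑_{ι : φ∘ι = w_σ} G(ι)`.
[cite: BurgisserIkenmeyer2017, eq. (3.4)] -/
theorem sum_wordBlockSign_comp_mul {N R D δ : ℕ} (e : Fin D ≃ Fin δ × Fin N) (φ : Fin R → Fin N)
    (G : (Fin D → Fin R) → ℂ) :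
    ∑ ι : Fin D → Fin R, wordBlockSign ℂ e (φ ∘ ι) * G ι =
      ∑ σ : Fin δ → Equiv.Perm (Fin N), (∏ a, ((Equiv.Perm.sign (σ a) : ℤ) : ℂ)) *
        ∑ ι : Fin D → Fin R, if (φ ∘ ι = fun q => σ (e q).1 (e q).2) then G ι else 0 := by
  classical
  have h1 : ∑ ι : Fin D → Fin R, wordBlockSign ℂ e (φ ∘ ι) * G ι =
      ∑ u : Word N D, wordBlockSign ℂ e u * ∑ ι : Fin D → Fin R, if φ ∘ ι = u then G ι else 0 := by
    symm
    rw [Finset.sum_congr rfl fun u _ => Finset.mul_sum _ _ _, Finset.sum_comm]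
    refine Finset.sum_congr rfl fun ι _ => ?_
    rw [Finset.sum_eq_single (φ ∘ ι)]
    · rw [if_pos rfl]
    · intro u _ hu
      rw [if_neg (Ne.symm hu), mul_zero]
    · intro h; exact absurd (Finset.mem_univ _) h
  have h2 := sum_wordBlockSign_mul e (fun u : Word N D => ∑ ι : Fin D → Fin R, if φ ∘ ι = u then G ι else 0)
  rw [h1, h2]

/-- At the indicator colouring of a word `x`, `∑_w M(w) ∏_q [w q = x q] = M(x)`. [folklore] -/
theorem sum_mul_prod_indicator_word_eq {N D : ℕ} (M : Word N D → ℂ) (x : Word N D) :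
    (∑ w : Word N D, M w * ∏ q, (if w q = x q then (1 : ℂ) else 0)) = M x := by
  classical
  rw [Finset.sum_eq_single x]
  · simp
  · intro w _ hw
    obtain ⟨q, hq⟩ : ∃ q, w q ≠ x q := by
      by_contra h
      exact hw (funext fun q => not_not.1 (not_exists.1 h q))
    rw [Finset.prod_eq_zero (Finset.mem_univ q) (if_neg hq), mul_zero]
  · intro h
    exact absurd (Finset.mem_univ _) h

/-! ### §4 The storey law -/

/-- **The two-rectangle STOREY LAW (general witness).**  Let `λ⁰ = λ¹ = (δ^N)`, `M` a highest-weight vector of weight `λ²` on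
words of length `Nδ`, `φ, ψ : [R] → [N]` collision maps, `c` an `R × N` matrix and `e, e'` block structures.  If
`∑_{ι : [Nδ] → [R]} ζ_e(φ∘ι) ζ_{e'}(ψ∘ι) ∑_w M(w) ∏_q c_{ι q, w q} ≠ 0`, then `(λ⁰,λ¹,λ²)` occurs for `⟨m⟩` for every
`m ≥ max(N, R)`: the lifted slice `t_{φ,ψ}(c)` has border rank `≤ R` and the pairing of §3 is an occurrence witness. [this node] -/
theorem occurs_unitTensor_twoRectangle_of_liftPairing_ne_zero {N R δ m : ℕ} (hNm : N ≤ m) (hRm : R ≤ m)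
    (φ ψ : Fin R → Fin N) (e e' : Fin (N * δ) ≃ Fin δ × Fin N) {lam : Fin 3 → Nat.Partition (N * δ)}
    (h0 : lam 0 = Nat.Partition.rectangle N δ) (h1 : lam 1 = Nat.Partition.rectangle N δ)
    {M : Word N (N * δ) → ℂ} (hM : M ∈ highestWeightSpace (wordRep ℂ N (N * δ)) (Weight.ofPartition N (lam 2)))
    (c : Fin R → Fin N → ℂ)
    (h : ∑ ι : Fin (N * δ) → Fin R, wordBlockSign ℂ e (φ ∘ ι) *
        (wordBlockSign ℂ e' (ψ ∘ ι) * ∑ w, M w * ∏ q, c (ι q) (w q)) ≠ 0) :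
    isotypicSum₁ (lam 0) (isotypicSum₂ (lam 1) (isotypicSum₃ (lam 2) (kroneckerPow (unitTensor ℂ m) (N * δ)))) ≠ 0 := by
  classical
  refine occurs_unitTensor_of_algBorderRank_le hNm _ ((algBorderRank_liftSlice_le φ ψ c).trans hRm) (N * δ) lam ?_
  have hmem : (fun t : Word3 N (N * δ) => wordBlockSign ℂ e t.1.1 * wordBlockSign ℂ e' t.1.2 * M t.2) ∈
      tripleHw ℂ N (N * δ) (Weight.ofPartition N (lam 0)) (Weight.ofPartition N (lam 1))
        (Weight.ofPartition N (lam 2)) := by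
    rw [h0, h1]; exact blockSign_blockSign_mem_tripleHw e e' hM
  refine isotypicSum₁₂₃_kroneckerPow_ne_zero_of_pairing_tripleHw_ne_zero hmem ?_
  rw [show (∑ u, ∑ v, ∑ w,
      kroneckerPow (fun i j l : Fin N => ∑ r : Fin R, if φ r = i ∧ ψ r = j then c r l else 0) (N * δ) u v w *
        (fun t : Word3 N (N * δ) => wordBlockSign ℂ e t.1.1 * wordBlockSign ℂ e' t.1.2 * M t.2) ((u, v), w)) =
      ∑ u, ∑ v, ∑ w,
        kroneckerPow (fun i j l : Fin N => ∑ r : Fin R, if φ r = i ∧ ψ r = j then c r l else 0) (N * δ) u v w *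
          (wordBlockSign ℂ e u * wordBlockSign ℂ e' v * M w) from rfl]
  rwa [pairing_liftSlice_blockSign_blockSign]

/-- **The two-rectangle STOREY LAW (design form).**  With the indicator colouring `c_r = δ_{γ r}` of a third map
`γ : [R] → [N]` the witness is the rank-`≤ R` tensor `t_{φ,ψ,γ} = ∑_{r<R} e_{φ r} ⊗ e_{ψ r} ⊗ e_{γ r}` and the criterion reads:
`∑_{ι : [Nδ] → [R]} ζ_e(φ∘ι) · ζ_{e'}(ψ∘ι) · M(γ∘ι) ≠ 0 ⟹ ((δ^N),(δ^N),λ²) ∈ S(⟨m⟩)` for all `m ≥ max(N,R)`. [this node] -/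
theorem occurs_unitTensor_twoRectangle_of_liftDesign_ne_zero {N R δ m : ℕ} (hNm : N ≤ m) (hRm : R ≤ m)
    (φ ψ γ : Fin R → Fin N) (e e' : Fin (N * δ) ≃ Fin δ × Fin N) {lam : Fin 3 → Nat.Partition (N * δ)}
    (h0 : lam 0 = Nat.Partition.rectangle N δ) (h1 : lam 1 = Nat.Partition.rectangle N δ)
    {M : Word N (N * δ) → ℂ} (hM : M ∈ highestWeightSpace (wordRep ℂ N (N * δ)) (Weight.ofPartition N (lam 2)))
    (h : ∑ ι : Fin (N * δ) → Fin R, wordBlockSign ℂ e (φ ∘ ι) * (wordBlockSign ℂ e' (ψ ∘ ι) * M (γ ∘ ι)) ≠ 0) :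
    isotypicSum₁ (lam 0) (isotypicSum₂ (lam 1) (isotypicSum₃ (lam 2) (kroneckerPow (unitTensor ℂ m) (N * δ)))) ≠ 0 := by
  classical
  refine occurs_unitTensor_twoRectangle_of_liftPairing_ne_zero hNm hRm φ ψ e e' h0 h1 hM
    (fun r l => if l = γ r then (1 : ℂ) else 0) ?_
  have hc : ∀ ι : Fin (N * δ) → Fin R,
      (∑ w, M w * ∏ q, (fun r l : Fin _ => if l = γ r then (1 : ℂ) else 0) (ι q) (w q)) = M (γ ∘ ι) :=
    fun ι => sum_mul_prod_indicator_word_eq M (γ ∘ ι)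
  simp_rw [hc]
  exact h

/-- **Storey law, collapsed against the first block sign**: the criterion of the design form equals
`∑_{σ ∈ S_N^δ} sgn(σ) ∑_{ι : φ∘ι = w_σ} ζ_{e'}(ψ∘ι) M(γ∘ι)` — the form in which designs are evaluated by hand (one `σ` at a
time, the `ι` over `w_σ` being its LIFTS). [this node] -/
theorem liftDesign_sum_eq_sum_perm {N R δ δ' : ℕ} (φ ψ γ : Fin R → Fin N) (e : Fin (N * δ) ≃ Fin δ × Fin N)
    (e' : Fin (N * δ) ≃ Fin δ' × Fin N) (M : Word N (N * δ) → ℂ) :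
    ∑ ι : Fin (N * δ) → Fin R, wordBlockSign ℂ e (φ ∘ ι) * (wordBlockSign ℂ e' (ψ ∘ ι) * M (γ ∘ ι)) =
      ∑ σ : Fin δ → Equiv.Perm (Fin N), (∏ a, ((Equiv.Perm.sign (σ a) : ℤ) : ℂ)) *
        ∑ ι : Fin (N * δ) → Fin R, if (φ ∘ ι = fun q => σ (e q).1 (e q).2) then
          wordBlockSign ℂ e' (ψ ∘ ι) * M (γ ∘ ι) else 0 :=
  sum_wordBlockSign_comp_mul e φ _

end Summit.MatrixMultiplication.MatrixMultiplication.Theorems.ObstructionCalculus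

end
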